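import Summits.CriticalPhenomena.CardyFormulaZ2.Theorems.CardyBoundaryCoulombGasBoundaryDefectGaussianRStubRealisabilityPart4
import Literature.Probability.LatticeModels.CollarLegModelRainbow

/-!
# Stub `stub_dictionaryPositivity` of line `rainbow-monomials-in-excursion-kernels` — D2 completion,
# sub-goal `s17_norm_Zins_pos_of_dictionary`: positivity of the rainbow ratio from the dictionary
# (crux `BoundaryDefectGaussianR`, stmt-CriticalPhenomena-14132; insertion dictionary D2, layer 4)

Glue of the D2 completion skeleton: once the insertion dictionary `‖Zins V ι‖ = #{ω ⊆ E : Rainbow ι V ω}`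
holds and some set of live edges is rainbow, the numerator is a positive natural number, and on a
hole-free collar domain the denominator is `‖Z(ofDomain V)‖ = 2^{|E|} > 0` (closed-collar dictionary
D1, `norm_Z_ofDomain_pos`, …StubRealisabilityPart4); hence `0 < ‖Zins‖ / ‖Z‖`. Registered sub-goal
`s17_norm_Zins_pos_of_dictionary` of stmt-CriticalPhenomena-14132.
-/

noncomputable section

namespace Summit.CriticalPhenomena.CardyFormulaZ2.Cruxes.BoundaryDefectGaussianR.RainbowMonomialsInExcursionKernels

open Finset Literature.Probability.LatticeModels Literature.Probability.LatticeModels.CollarLegModel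

/-- **Positivity of the rainbow ratio from the dictionary** (registered sub-goal
`s17_norm_Zins_pos_of_dictionary`): on a collar domain `V` with king-connected complement, if
`‖Zins V ι‖` equals the number of rainbow sets of live edges and some set of live edges is rainbow,
then `0 < ‖Zins V ι‖ / ‖Z(ofDomain V)‖`. [cite: BaxterKellandWu1976, §3–§4] -/
theorem s17_norm_Zins_pos_of_dictionary : ∀ (ι : Literature.Probability.LatticeModels.CollarLegModel.LegInsertionData) (V : Finset (ℤ × ℤ)) [DecidablePred fun ω : Finset ((ℤ × ℤ) × Bool) => ι.Rainbow V ω], (∀ u ∉ V, ∀ w ∉ V, Relation.ReflTransGen (fun b c : ℤ × ℤ ↦ b ∉ V ∧ c ∉ V ∧ max |b.1 - c.1| |b.2 - c.2| ≤ 1) u w) → ‖Literature.Probability.LatticeModels.CollarLegModel.Zins V ι‖ = ((((ι.model V).E.powerset.filter (fun ω => ι.Rainbow V ω)).card : ℕ) : ℝ) → (∃ ω : Finset ((ℤ × ℤ) × Bool), ω ⊆ (ι.model V).E ∧ ι.Rainbow V ω) → 0 < ‖Literature.Probability.LatticeModels.CollarLegModel.Zins V ι‖ / ‖(Literature.Probability.LatticeModels.CollarLegModel.ofDomain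 V).Z‖ := by
  intro ι V _ hV hdict hex
  obtain ⟨ω, hωE, hωR⟩ := hex
  refine div_pos ?_ (norm_Z_ofDomain_pos hV)
  rw [hdict]
  have hmem : ω ∈ (ι.model V).E.powerset.filter (fun ω => ι.Rainbow V ω) :=
    mem_filter.2 ⟨mem_powerset.2 hωE, hωR⟩
  exact_mod_cast card_pos.2 ⟨ω, hmem⟩

end Summit.CriticalPhenomena.CardyFormulaZ2.Cruxes.BoundaryDefectGaussianR.RainbowMonomialsInExcursionKernels

end
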